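import Summits.BirchSwinnertonDyer.BirchSwinnertonDyer.Theorems.AdditiveBranchIMCMultLowerFieldSupplyMSign
import HarnessLib

/-!
# Route `ErratumRoadFive` (K2), crux `EulerHalfNotRamNoInertSetAtFive` (stmt-BirchSwinnertonDyer-19715), crux idea
# `ramified-twin-ram-transport` — the SIGN LAW for a REAL ramified twist at an additive potentially
# multiplicative prime (helper for the genus-frame FIELD SUPPLY, LEAD g7 TURNKEY §8 stub S1)

Cell `bsd-stepL`, width seat `bsd-line-er5-p1-w5` (g5). THEOREMS ONLY; no definition, no named fact, no `sorry`.
Helper `--supports stmt-BirchSwinnertonDyer-19715`; it closes nothing by itself.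

WHY. On the served S1b class the source curve `W` has analytic rank ONE (`w(W) = −1`), so the auxiliary curve
`X` to which Friedberg–Hoffstein's all-split non-vanishing theorem is applied must be a REAL quadratic twist
`X ≅ W^{(q*ℓ₀*)}`, `q*ℓ₀* > 0`, ramified at the additive potentially multiplicative prime `q` (the rank-ZERO
source of bsd-addord's `ThreeFieldRoadSupply.exists_ramifiedClass_partner_mult` uses the imaginary one,
`p*T < 0`, via `rootNumber_mul_rootNumber_ramifiedTwist_of_multTwist`). This file is the `q*d' > 0` twin of
that tree theorem, with the same proof: the only sign-sensitive input is `(−1 / |d'|) = sign d'`, which is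
`+χ₄(q)` instead of `−χ₄(q)`.

CONTENT (namespace `…Theorems.EulerHalfGenusSupply`; `p` denotes the additive prime, as in the addord files):
* `jacobiSym_neg_one_natAbs_eq_of_pos` — `(−1 / |d'|) = χ₄(p)` when `p*·d' > 0`, `d' ≡ 1 (4)`;
* `rootNumber_mul_rootNumber_realRamifiedTwist_of_multTwist` — `w(E)·w(E^{(p*d')}) = +(d'/p)·W_p(E^{(p*)})`
  for `E^{(p*)}` MULTIPLICATIVE at `p`, `N_E = M p²` (`p ≥ 5`, `p ∤ M`), `d' ≡ 1 (4)` squarefree prime to `N_E`,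
  `p* d' > 0`, every prime of `M` split in `ℚ(√(p* d'))`; assuming only the Modularity Theorem;
* `rootNumber_mul_rootNumber_realRamifiedTwist_of_mult_model` — the same for `W` additive at `p` with a
  multiplicative twist model `C • W^{(p*)} = V` (the orientation of `RamifiedTwinRamTransport.exists_pStarTwistModel`
  and of `EulerHalfRamTwist.hasSplitMultiplicativeReductionAtPrime_ramTwist_iff`), `W_p(V) = −1` iff `V` is split.
In the supply (`…GenusFrameSupply.lean`) the Dirichlet prime `ℓ₀` is prescribed so that `(ℓ₀*/q) = W_q(V)`; then the
right-hand side is `W_q(V)² = +1`, i.e. `w(X) = w(W) = −1`.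

References: [Rohrlich1993Compositio] Prop. 2(ii),(iii); [AtkinLehner1970] §6; [KellockDokchitser2023] Rem. 2.2;
[MurtyMurty1997] Ch. 6 §1. Axioms: `propext`, `Classical.choice`, `Quot.sound`.
No summit statement is proved here; BSD is proved for no curve.
-/

set_option autoImplicit false
-- D-0017: single-problem summit, so `Summit.BirchSwinnertonDyer.BirchSwinnertonDyer.…` repeats a namespace BY DESIGN.
set_option linter.dupNamespace false

noncomputable section

open scoped Classical NumberTheorySymbols

open WeierstrassCurve Literature.NumberTheory.EllipticCurves Literature.NumberTheory.EllipticCurves.ModularForms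
  Literature.NumberTheory.EllipticCurves.Rank1Residual
  Summit.BirchSwinnertonDyer.Rank1Residual Summit.BirchSwinnertonDyer.Rank1Residual.Additive
  Summit.BirchSwinnertonDyer.BirchSwinnertonDyer.Theorems.AdditiveKoly.RamifiedHabitat
  Summit.BirchSwinnertonDyer.BirchSwinnertonDyer.Theorems.ThreeFieldRoadSupply

namespace Summit.BirchSwinnertonDyer.BirchSwinnertonDyer.Theorems.EulerHalfGenusSupply

section Sign

variable (W : WeierstrassCurve ℚ) [W.IsElliptic] (p : ℕ) [hp : Fact p.Prime]

/-- `(−1 / |d'|) = (−1/p)` when `p*·d' > 0` and `d' ≡ 1 (mod 4)`: `(−1/|d'|) = χ₄(|d'|) = sign d' = sign p* = χ₄(p)`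
(the `> 0` twin of `RamifiedHabitat.jacobiSym_neg_one_natAbs_eq_of_neg`). [folklore] -/
theorem jacobiSym_neg_one_natAbs_eq_of_pos (hp2 : p ≠ 2) {d' : ℤ} (hd'4 : d' % 4 = 1)
    (hpos : 0 < (-1 : ℤ) ^ (p / 2) * p * d') : J(-1 | d'.natAbs) = ZMod.χ₄ p := by
  have hodd : Odd d'.natAbs := Int.natAbs_odd.mpr (Int.odd_iff.mpr (by omega))
  rw [jacobiSym.at_neg_one hodd, ZMod.χ₄_nat_eq_if_mod_four, ZMod.χ₄_nat_eq_if_mod_four]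
  have hp' := (Nat.Prime.eq_two_or_odd (Fact.out : p.Prime)).resolve_left hp2
  have hp0 : (0 : ℤ) < p := by exact_mod_cast (Fact.out : p.Prime).pos
  rcases Nat.odd_mod_four_iff.mp hp' with hp4 | hp4
  · rw [ZMod.neg_one_pow_div_two_of_one_mod_four hp4, one_mul] at hpos
    have hd'pos : 0 < d' := by
      by_contra h; push Not at h
      exact absurd hpos (not_lt.mpr (by nlinarith))
    have h1 : (d'.natAbs : ℤ) = d' := Int.natAbs_of_nonneg hd'pos.le
    have h2 : d'.natAbs % 4 = 1 := by omega
    have h3 : d'.natAbs % 2 = 1 := by omega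
    simp [h2, h3, hp4, show p % 2 = 1 from hp']
  · rw [ZMod.neg_one_pow_div_two_of_three_mod_four hp4] at hpos
    have hd'neg : d' < 0 := by
      by_contra h; push Not at h
      exact absurd hpos (not_lt.mpr (by nlinarith))
    have h1 : (d'.natAbs : ℤ) = -d' := Int.ofNat_natAbs_of_nonpos hd'neg.le
    have h2 : d'.natAbs % 4 = 3 := by omega
    have h3 : d'.natAbs % 2 = 1 := by omega
    simp [h2, h3, hp4, show p % 2 = 1 from hp']

/-- **`w(E)·w(E^{(p*d')}) = +(d'/p)·W_p(E^{(p*)})` for a REAL ramified twist, `E^{(p*)}` MULTIPLICATIVE at `p`** —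
`N_E = M p²` (`p ≥ 5`, `p ∤ M`), `d' ≡ 1 (4)` squarefree prime to `N_E`, `p* d' > 0`, every prime of `M` split in
`ℚ(√(p* d'))`; assuming only the Modularity Theorem. The proof of
`ThreeFieldRoadSupply.rootNumber_mul_rootNumber_ramifiedTwist_of_multTwist` verbatim with `(−1/|d'|) = +χ₄(p)`
(coprime twisting law `rootNumber_quadraticTwist_of_emod_four_eq_one` on `E^{(p*)}` at level `M p`, the `p*`-law
`rootNumber_mul_rootNumber_pStarTwist_of_multTwist`, `(M/p)² = χ₄(p)² = 1`).
[cite: MurtyMurty1997, Ch. 6 §1] [cite: Rohrlich1993Compositio, Prop. 2(ii),(iii)] -/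
theorem rootNumber_mul_rootNumber_realRamifiedTwist_of_multTwist (hmod : exists_isNewformOf) (hp5 : 5 ≤ p)
    {M : ℕ} (hN : W.conductorNorm ℤ = M * p ^ 2) (hpM : ¬ p ∣ M)
    (hmult : (W.quadraticTwist (((-1 : ℤ) ^ (p / 2) * p : ℤ) : ℚ)).HasMultiplicativeReductionAtPrime p)
    {d' : ℤ} (hd'4 : d' % 4 = 1) (hd'sq : Squarefree d') (hgcd : Int.gcd d' (W.conductorNorm ℤ) = 1)
    (hpos : 0 < (-1 : ℤ) ^ (p / 2) * p * d')
    (hodd : ∀ q ∈ M.primeFactors, q ≠ 2 → J((-1 : ℤ) ^ (p / 2) * p * d' | q) = 1)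
    (htwo : 2 ∣ M → ((-1 : ℤ) ^ (p / 2) * p * d') % 8 = 1) :
    W.rootNumber * (W.quadraticTwist (((-1 : ℤ) ^ (p / 2) * p * d' : ℤ) : ℚ)).rootNumber =
      legendreSym p d' *
        ((W.quadraticTwist (((-1 : ℤ) ^ (p / 2) * p : ℤ) : ℚ)).baseChange ℚ_[p]).localRootNumber ℤ_[p] := by
  -- adapted from `ThreeFieldRoadSupply.rootNumber_mul_rootNumber_ramifiedTwist_of_multTwist` (sign flipped)
  have hp' : p.Prime := hp.out
  have hp2 : p ≠ 2 := by omega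
  have hdZ0 : ((-1 : ℤ) ^ (p / 2) * p : ℤ) ≠ 0 :=
    mul_ne_zero (pow_ne_zero _ (by norm_num)) (by exact_mod_cast hp'.ne_zero)
  have hd0 : (((((-1 : ℤ) ^ (p / 2) * p : ℤ)) : ℚ)) ≠ 0 := by exact_mod_cast hdZ0
  haveI hE' : (W.quadraticTwist (((-1 : ℤ) ^ (p / 2) * p : ℤ) : ℚ)).IsElliptic :=
    W.isElliptic_quadraticTwist hd0
  have hM0 : M ≠ 0 := by
    intro h; rw [h, zero_mul] at hN; exact (W.conductorNorm_pos_holds).ne' hN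
  have hA := rootNumber_mul_rootNumber_pStarTwist_of_multTwist W p hmod hp5 hN hpM hmult
  have hN' := conductorNorm_pStarTwist_eq_mul_of_mult W hp5 hN hpM hmult
  have hgcd' : Int.gcd d' ((W.quadraticTwist (((-1 : ℤ) ^ (p / 2) * p : ℤ) : ℚ)).conductorNorm ℤ) = 1 := by
    rw [hN']
    have h1 := Int.isCoprime_iff_gcd_eq_one.mpr hgcd
    rw [hN] at h1
    push_cast at h1 ⊢
    rw [sq, ← mul_assoc] at h1
    exact Int.isCoprime_iff_gcd_eq_one.mp h1.of_mul_right_left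
  have hB := ((W.quadraticTwist (((-1 : ℤ) ^ (p / 2) * p : ℤ) : ℚ)).rootNumber_quadraticTwist_of_emod_four_eq_one
    hmod hd'4 hd'sq hgcd').1
  rw [quadraticTwist_quadraticTwist, hN'] at hB
  have hcast : ((((-1 : ℤ) ^ (p / 2) * p : ℤ) : ℚ)) * (d' : ℚ) = (((-1 : ℤ) ^ (p / 2) * p * d' : ℤ) : ℚ) := by
    push_cast; ring
  rw [hcast] at hB
  have hNe0 : NeZero d'.natAbs := ⟨Int.natAbs_ne_zero.mpr (by rintro rfl; norm_num at hd'4)⟩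
  have hpodd : Odd p := (Nat.Prime.eq_two_or_odd' hp').resolve_left hp2
  have hJM : J(((M * p : ℕ) : ℤ) | d'.natAbs) = legendreSym p M * legendreSym p d' := by
    rw [Nat.cast_mul, jacobiSym.mul_left, jacobiSym_natAbs_eq_legendreSym_of_split_anyLevel hp2 hd'4 hM0 hodd htwo,
      Literature.NumberTheory.QuadraticFields.jacobiSym_natAbs_eq_of_emod_four_eq_one hd'4 hpodd,
      ← jacobiSym.legendreSym.to_jacobiSym]
  have hJ1 := jacobiSym_neg_one_natAbs_eq_of_pos p hp2 hd'4 hpos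
  have hM2 : legendreSym p M * legendreSym p M = 1 := by
    rw [← sq]
    refine legendreSym.sq_one p ?_
    rw [Int.cast_natCast, ne_eq, ZMod.natCast_eq_zero_iff]
    exact hpM
  have hχ₄ := χ₄_mul_self_of_ne_two (p := p) hp2
  set w' := ((W.quadraticTwist (((-1 : ℤ) ^ (p / 2) * p : ℤ) : ℚ)).baseChange ℚ_[p]).localRootNumber ℤ_[p]
  calc W.rootNumber * (W.quadraticTwist (((-1 : ℤ) ^ (p / 2) * p * d' : ℤ) : ℚ)).rootNumber
      = J(-1 | d'.natAbs) * J(((M * p : ℕ) : ℤ) | d'.natAbs) *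
          (W.rootNumber * (W.quadraticTwist (((-1 : ℤ) ^ (p / 2) * p : ℤ) : ℚ)).rootNumber) := by rw [hB]; ring
    _ = ZMod.χ₄ p * (legendreSym p M * legendreSym p d') * (legendreSym p M * ZMod.χ₄ p * w') := by
        rw [hJ1, hJM, hA]
    _ = legendreSym p d' * w' := by
        linear_combination (legendreSym p d' * w' * (ZMod.χ₄ p * ZMod.χ₄ p)) * hM2 + (legendreSym p d' * w') * hχ₄

/-- **The real ramified-twist sign law in the ramified-twin presentation.** `W` additive at `p ≥ 5` with a
multiplicative twist model `C • W^{(p*)} = V` (`V` MULTIPLICATIVE at `p`); `d' ≡ 1 (4)` squarefree prime to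
`N_W`, `p* d' > 0`, every bad prime `ℓ ≠ p` of `W` split in `ℚ(√(p* d'))`. Then, assuming only the Modularity
Theorem, `w(W)·w(W^{(p* d')}) = +(d'/p)·W_p(V)` with `W_p(V) = −1` if `V` is split and `+1` if `V` is non-split
at `p` (Rohrlich Prop. 2(ii)). [cite: Rohrlich1993Compositio, Prop. 2(ii),(iii)] [cite: MurtyMurty1997, Ch. 6 §1] -/
theorem rootNumber_mul_rootNumber_realRamifiedTwist_of_mult_model (hmod : exists_isNewformOf) (hp5 : 5 ≤ p)
    (hadd : Addv W p) (V : WeierstrassCurve ℚ) [V.IsElliptic] (C : VariableChange ℚ)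
    (hV : C • W.quadraticTwist ((-1 : ℚ) ^ (p / 2) * p) = V) (hmultV : V.HasMultiplicativeReductionAtPrime p)
    {d' : ℤ} (hd'4 : d' % 4 = 1) (hd'sq : Squarefree d') (hgcd : Int.gcd d' (W.conductorNorm ℤ) = 1)
    (hpos : 0 < (-1 : ℤ) ^ (p / 2) * p * d')
    (hodd : ∀ ℓ : ℕ, ℓ.Prime → ℓ ∣ W.conductorNorm ℤ → ℓ ≠ p → ℓ ≠ 2 → J((-1 : ℤ) ^ (p / 2) * p * d' | ℓ) = 1)
    (htwo : 2 ∣ W.conductorNorm ℤ → ((-1 : ℤ) ^ (p / 2) * p * d') % 8 = 1) :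
    W.rootNumber * (W.quadraticTwist (((-1 : ℤ) ^ (p / 2) * p * d' : ℤ) : ℚ)).rootNumber =
      legendreSym p d' * (if V.HasSplitMultiplicativeReductionAtPrime p then -1 else 1) := by
  have hp' : p.Prime := hp.out
  have hp2 : p ≠ 2 := by omega
  obtain ⟨M, hN, hpM⟩ := conductorNorm_eq_mul_sq_of_addv W p hp5 hadd
  have hM0 : M ≠ 0 := by
    intro h; rw [h, zero_mul] at hN; exact (W.conductorNorm_pos_holds).ne' hN
  -- `W^{(p*)} = C⁻¹ • V`
  have hcast : ((((-1 : ℤ) ^ (p / 2) * p : ℤ)) : ℚ) = (-1 : ℚ) ^ (p / 2) * p := by push_cast; ring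
  have hW' : W.quadraticTwist ((((-1 : ℤ) ^ (p / 2) * p : ℤ)) : ℚ) = C⁻¹ • V := by
    rw [hcast, ← hV, inv_smul_smul]
  have hmult : (W.quadraticTwist (((-1 : ℤ) ^ (p / 2) * p : ℤ) : ℚ)).HasMultiplicativeReductionAtPrime p := by
    rw [hW']; exact (hasMultiplicativeReductionAtPrime_smul_iff V _ p).mpr hmultV
  have hsplit_iff : (W.quadraticTwist (((-1 : ℤ) ^ (p / 2) * p : ℤ) : ℚ)).HasSplitMultiplicativeReductionAtPrime p ↔
      V.HasSplitMultiplicativeReductionAtPrime p := by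
    rw [hW']; exact hasSplitMultiplicativeReductionAtPrime_smul_iff V _ p
  have hodd' : ∀ q ∈ M.primeFactors, q ≠ 2 → J((-1 : ℤ) ^ (p / 2) * p * d' | q) = 1 := by
    intro q hq hq2
    obtain ⟨hqprime, hqM⟩ := Nat.mem_primeFactors_of_ne_zero hM0 |>.mp hq
    have hqp : q ≠ p := by rintro rfl; exact hpM hqM
    exact hodd q hqprime (by rw [hN]; exact hqM.mul_right _) hqp hq2
  have htwo' : 2 ∣ M → ((-1 : ℤ) ^ (p / 2) * p * d') % 8 = 1 := fun h2 ↦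
    htwo (by rw [hN]; exact h2.mul_right _)
  rw [rootNumber_mul_rootNumber_realRamifiedTwist_of_multTwist W p hmod hp5 hN hpM hmult hd'4 hd'sq hgcd hpos hodd'
    htwo']
  congr 1
  by_cases hs : V.HasSplitMultiplicativeReductionAtPrime p
  · rw [if_pos hs]
    exact localRootNumber_of_hasSplitMultiplicativeReduction ℤ_[p] _ (hsplit_iff.mpr hs)
  · rw [if_neg hs]
    exact localRootNumber_of_hasMultiplicativeReduction ℤ_[p] _ hmult (fun h ↦ hs (hsplit_iff.mp h))

end Sign

end Summit.BirchSwinnertonDyer.BirchSwinnertonDyer.Theorems.EulerHalfGenusSupply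

end
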